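import Summits.BirchSwinnertonDyer.BirchSwinnertonDyer.Theses.ShaPrimaryTransfer
import Summits.BirchSwinnertonDyer.BirchSwinnertonDyer.Theorems.ShaPrimaryTransferFiniteShaComponentTransferDoorAtThree
import Literature.NumberTheory.EllipticCurves.Skinner2016.SelmerCorankOfVanishingLValue
import Literature.NumberTheory.EllipticCurves.NonEisensteinPrimeOfSurjective
import Literature.NumberTheory.EllipticCurves.BSDSelmerParityDokchitserProofs

/-!
# BirchSwinnertonDyer / ShaPrimaryTransfer — crux `FiniteShaComponentTransfer` (stmt-BirchSwinnertonDyer-22356):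
# the rank-ZERO door at `3` and at MULTIPLICATIVE primes `p ≥ 3` — Skinner 2016 Theorem C (2)

Sixth helper file of prover seat `bsd-line-spt-p1` (`--supports stmt-22356 --as helper`). The companions list as
open residue of T = `FiniteShaComponentTransfer` in algebraic rank ≤ 1 the door at `p ∈ {2, 3}` and at BAD
primes (`…Sectors`, g0), and close the door at `3` in rank ONE through Burungale–Skinner–Tian–Wan 2024
(`…DoorAtThree`, g2). The tree meanwhile carries, typed verbatim, C. Skinner, *Multiplicative reduction and the
cyclotomic main conjecture for GL₂*, Pacific J. Math. 283 (2016), **Theorem C, clause (2)** — «`L(E,1) = 0 ⟹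
corank_{ℤ_p} Sel_{p^∞}(E) ≥ 1`» at a prime `p ≥ 3` of good ordinary OR MULTIPLICATIVE reduction under (irr) `E[p]`
irreducible and (ram) a multiplicative prime `ℓ ≠ p` at which `E[p]` is ramified — as the named fact
`Skinner2016.thmC_one_le_selmerCorank_of_L_one_eq_zero`, with its contrapositive
`Skinner2016.analyticRank_eq_zero_of_selmerCorank_eq_zero_of_thmC` («corank 0 ⟹ `ord_{s=1} L(E,s) = 0`»).
That is exactly a rank-ZERO `p`-converse at the two kinds of door prime the census had open in rank 0:

* `transfer_of_mordellWeilRank_eq_zero_of_thmC` — rank `0`, door at `p ≥ 3` good ordinary or multiplicative,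
  (irr) + (ram): `t_p(E) = 0 ⟹ t_q(E) = 0` at EVERY prime `q` (door ⟹ `corank Sel_{p^∞} = rank = 0` by Greenberg's
  identity ⟹ `L(E,1) ≠ 0` by Theorem C (2) ⟹ `Ш(E)` finite by Gross–Zagier–Kolyvagin `hGZK`).
* `transfer_doorMultiplicative_rank_zero` — the MULTIPLICATIVE door (`p ≥ 3`, `p = 3` included) in rank `0`.
* `transfer_doorAtThree_rank_zero` — the door at `3` (good ordinary or multiplicative at `3`) in rank `0`.
* `transfer_doorAtThree_rank_le_one_of_surjective` — with `…DoorAtThree.transfer_doorAtThree_rank_one` (BSTW, rank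
  `1`, good ordinary at `3`, `ρ̄_{E,3}` surjective): the good ordinary door at `3` in rank `≤ 1` under «`ρ̄_{E,3}`
  surjective + (ram)» (surjective ⟹ irreducible, tree theorem `hasIrreducibleModPGaloisRep_of_hasSurjectiveModNGaloisRep`).

What stays open at these doors after this file (numbers, not adjectives): rank `1` at a MULTIPLICATIVE door (the
tree's only multiplicative rank-one converse is the OPEN binder `SkinnerZhang2014` Thm. 1.1, unrefereed); every
door without (ram) (no multiplicative prime, e.g. all of conductor `p^k`) or with `E[p]` reducible at `p = 3`; and,
as everywhere, rank ≥ 2. The registry flags Theorem C at `p = 3` as inheriting Skinner–Urban's print gap (see the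
fact's docstring); the flag travels with `hC`. CONDITIONAL on the named hypotheses; nothing here proves T or BSD.

References: C. Skinner, Pacific J. Math. 283 (2016), Thm. C; A. Burungale, C. Skinner, Y. Tian, X. Wan,
arXiv:2409.01350 (2024), Thm. 1.10; R. Greenberg, LNM 1716 (1999), §1; V. Kolyvagin (1990), Thm. A / Gross–Zagier
(1986) via H. Darmon, CBMS 101 (2004), Thm. 3.22.
-/

-- D-0017: single-problem summit, so `Summit.BirchSwinnertonDyer.BirchSwinnertonDyer.…` repeats a namespace BY DESIGN.
set_option linter.dupNamespace false

noncomputable section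

namespace Summit.BirchSwinnertonDyer.BirchSwinnertonDyer.Theorems.ShaPrimaryTransferDoorSkinnerC

open scoped Classical
open Literature.NumberTheory.EllipticCurves
open WeierstrassCurve
open Summit.BirchSwinnertonDyer.BirchSwinnertonDyer.Theorems

/-- **Transfer in rank `0` from a door prime `p ≥ 3` of good ordinary OR multiplicative reduction (Skinner 2016
Thm. C (2) + GZK).** For `E/ℚ` on a global minimal model with `rank E(ℚ) = 0`, a prime `p ≥ 3`, good ordinary or
multiplicative at `p`, with `E[p]` irreducible and a multiplicative prime `ℓ ≠ p` with `p ∤ v_ℓ(Δ_min)` ((ram)), and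
`t_p(E) = corank_{ℤ_p} Ш(E)[p^∞] = 0`: every `t_q(E)` vanishes. Proof: `corank Sel_{p^∞} = rank + t_p = 0` (Greenberg's
identity, tree theorem `selmerCorank_eq_mordellWeilRank_add_holds`); Theorem C (2) (`hC`, contrapositive
`Skinner2016.analyticRank_eq_zero_of_selmerCorank_eq_zero_of_thmC`) gives `ord_{s=1} L(E,s) = 0`; Gross–Zagier–Kolyvagin
(`hGZK`) makes `Ш(E/ℚ)` finite; a finite `q`-primary group has corank `0`. CONDITIONAL on `hC`, `hGZK`.
[cite: Skinner2016PacificMC, Thm. C (§1, p. 173), clause (2)] [cite: Darmon2004, Thm. 3.22 (= Thm. 1.14) and §3.9] -/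
theorem transfer_of_mordellWeilRank_eq_zero_of_thmC
    (hC : Skinner2016.thmC_one_le_selmerCorank_of_L_one_eq_zero)
    (hGZK : rank_eq_analyticRank_of_analyticRank_le_one)
    (W : WeierstrassCurve ℚ) [W.IsElliptic] [W.IsGloballyMinimal] (p q : ℕ) [Fact p.Prime] [Fact q.Prime]
    (hp : 3 ≤ p)
    (hred : (W.HasGoodReductionAtPrime p ∧ ¬ (p : ℤ) ∣ W.frobeniusTrace p) ∨
      W.HasMultiplicativeReductionAtPrime p)
    (hirr : W.HasIrreducibleModPGaloisRep p)
    (hram : ∃ ℓ : ℕ, ∃ _ : Fact ℓ.Prime, ℓ ≠ p ∧ W.HasMultiplicativeReductionAtPrime ℓ ∧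
      ¬ p ∣ padicValInt ℓ W.minimalDiscriminantInt)
    (hr : W.mordellWeilRank = 0) (h0 : W.shaCorank p = 0) : W.shaCorank q = 0 := by
  have hs : W.selmerCorank p = 0 := by
    rw [W.selmerCorank_eq_mordellWeilRank_add_holds p, hr, h0]
  have ha : W.analyticRank = 0 :=
    Skinner2016.analyticRank_eq_zero_of_selmerCorank_eq_zero_of_thmC hC W p hp hred hirr hram hs
  haveI : Finite ↥W.sha := (hGZK W (by omega)).2
  exact W.shaCorank_eq_zero_of_finite q

/-- **The MULTIPLICATIVE door in rank `0`** (`p ≥ 3`, split or non-split, `E[p]` irreducible, (ram)): `t_p(E) = 0 ⟹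
t_q(E) = 0` at every prime `q`, granting Skinner 2016 Thm. C (2) and GZK. This is the first BAD door prime at which
the tree closes a cell of T. CONDITIONAL on `hC`, `hGZK`. [cite: Skinner2016PacificMC, Thm. C (§1, p. 173), clause (2)]
[cite: Darmon2004, Thm. 3.22 (= Thm. 1.14) and §3.9] -/
theorem transfer_doorMultiplicative_rank_zero
    (hC : Skinner2016.thmC_one_le_selmerCorank_of_L_one_eq_zero)
    (hGZK : rank_eq_analyticRank_of_analyticRank_le_one)
    (W : WeierstrassCurve ℚ) [W.IsElliptic] [W.IsGloballyMinimal] (p q : ℕ) [Fact p.Prime] [Fact q.Prime]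
    (hp : 3 ≤ p) (hmult : W.HasMultiplicativeReductionAtPrime p) (hirr : W.HasIrreducibleModPGaloisRep p)
    (hram : ∃ ℓ : ℕ, ∃ _ : Fact ℓ.Prime, ℓ ≠ p ∧ W.HasMultiplicativeReductionAtPrime ℓ ∧
      ¬ p ∣ padicValInt ℓ W.minimalDiscriminantInt)
    (hr : W.mordellWeilRank = 0) (h0 : W.shaCorank p = 0) : W.shaCorank q = 0 :=
  transfer_of_mordellWeilRank_eq_zero_of_thmC hC hGZK W p q hp (Or.inr hmult) hirr hram hr h0

/-- **The door at `3` in rank `0`** (good ordinary or multiplicative at `3`, `E[3]` irreducible, a multiplicative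
`ℓ ≠ 3` with `3 ∤ v_ℓ(Δ_min)`): `t_3(E) = 0 ⟹ t_q(E) = 0` at every prime `q`, granting Skinner 2016 Thm. C (2) (at
`p = 3` the fact carries the registry's Skinner–Urban print flag) and GZK. CONDITIONAL on `hC`, `hGZK`.
[cite: Skinner2016PacificMC, Thm. C (§1, p. 173), clause (2), footnote 1, §2.5]
[cite: Darmon2004, Thm. 3.22 (= Thm. 1.14) and §3.9] -/
theorem transfer_doorAtThree_rank_zero
    (hC : Skinner2016.thmC_one_le_selmerCorank_of_L_one_eq_zero)
    (hGZK : rank_eq_analyticRank_of_analyticRank_le_one)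
    (W : WeierstrassCurve ℚ) [W.IsElliptic] [W.IsGloballyMinimal] (q : ℕ) [Fact q.Prime]
    (hred : (W.HasGoodReductionAtPrime 3 ∧ ¬ ((3 : ℕ) : ℤ) ∣ W.frobeniusTrace 3) ∨
      W.HasMultiplicativeReductionAtPrime 3)
    (hirr : W.HasIrreducibleModPGaloisRep 3)
    (hram : ∃ ℓ : ℕ, ∃ _ : Fact ℓ.Prime, ℓ ≠ 3 ∧ W.HasMultiplicativeReductionAtPrime ℓ ∧
      ¬ 3 ∣ padicValInt ℓ W.minimalDiscriminantInt)
    (hr : W.mordellWeilRank = 0) (h0 : W.shaCorank 3 = 0) : W.shaCorank q = 0 :=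
  haveI : Fact (Nat.Prime 3) := ⟨Nat.prime_three⟩
  transfer_of_mordellWeilRank_eq_zero_of_thmC hC hGZK W 3 q le_rfl hred hirr hram hr h0

/-- **The good ordinary door at `3` in rank `≤ 1` under «`ρ̄_{E,3}` surjective + (ram)»**: rank `0` by Skinner 2016
Thm. C (2) (`hC`; surjective ⟹ irreducible, tree theorem `hasIrreducibleModPGaloisRep_of_hasSurjectiveModNGaloisRep`),
rank `1` by Burungale–Skinner–Tian–Wan 2024 Thm. 1.10 (`hBSTW`, landed `ShaPrimaryTransferDoorAtThree.transfer_doorAtThree_rank_one`),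
both closed by GZK (`hGZK`): `t_3(E) = 0 ⟹ t_q(E) = 0` at every prime `q`. CONDITIONAL on `hC`, `hBSTW`, `hGZK`.
[cite: Skinner2016PacificMC, Thm. C (§1, p. 173), clause (2)] [cite: BurungaleSkinnerTianWan2024, Thm. 1.10]
[cite: Darmon2004, Thm. 3.22 (= Thm. 1.14) and §3.9] -/
theorem transfer_doorAtThree_rank_le_one_of_surjective
    (hC : Skinner2016.thmC_one_le_selmerCorank_of_L_one_eq_zero)
    (hBSTW : burungaleSkinnerTianWan_analyticRank_eq_one_of_selmerCorank_eq_one)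
    (hGZK : rank_eq_analyticRank_of_analyticRank_le_one)
    (W : WeierstrassCurve ℚ) [W.IsElliptic] [W.IsGloballyMinimal] (q : ℕ) [Fact q.Prime]
    (hgood : W.HasGoodReductionAtPrime 3) (hord : ¬ ((3 : ℕ) : ℤ) ∣ W.frobeniusTrace 3)
    (hsurj : W.HasSurjectiveModNGaloisRep 3)
    (hram : ∃ ℓ : ℕ, ∃ _ : Fact ℓ.Prime, ℓ ≠ 3 ∧ W.HasMultiplicativeReductionAtPrime ℓ ∧
      ¬ 3 ∣ padicValInt ℓ W.minimalDiscriminantInt)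
    (hr : W.mordellWeilRank ≤ 1) (h0 : W.shaCorank 3 = 0) : W.shaCorank q = 0 := by
  haveI : Fact (Nat.Prime 3) := ⟨Nat.prime_three⟩
  rcases Nat.le_one_iff_eq_zero_or_eq_one.1 hr with hr0 | hr1
  · haveI : NeZero ((3 : ℕ) : ℚ) := ⟨by norm_num⟩
    have hirr : W.HasIrreducibleModPGaloisRep 3 :=
      hasIrreducibleModPGaloisRep_of_hasSurjectiveModNGaloisRep W 3 hsurj
    exact transfer_doorAtThree_rank_zero hC hGZK W q (Or.inl ⟨hgood, hord⟩) hirr hram hr0 h0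
  · exact ShaPrimaryTransferDoorAtThree.transfer_doorAtThree_rank_one hBSTW hGZK W q hgood hord hsurj hram hr1 h0

end Summit.BirchSwinnertonDyer.BirchSwinnertonDyer.Theorems.ShaPrimaryTransferDoorSkinnerC
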